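import Summits.HubbardSuperconductivity.HubbardSuperconductivity.Theorems.AnisotropyChordSpinMonotoneTowerOverlapTwoMagnon
import Summits.HubbardSuperconductivity.HubbardSuperconductivity.Theorems.AnisotropyChordConcavityCycleSevenGraph

/-!
# Route `AnisotropyChord`: the first rung of ENERGY CONVEXITY (E-CONV) — no two-magnon bound state
# below the one-magnon line on connected vertex- and edge-transitive graphs, all `Δ < 1`

**Theorem** (`energyConvex_oneMagnon_of_edgeTransitive`).  `G` finite, connected, vertex- and
edge-transitive with at least two vertices, `H(Δ) = xxzHamiltonian 1 G (−1) Δ`, `E(M)` the lowest energy of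
the sector `S^z_tot = M`.  For every `Δ < 1`:

  `2 · E(|V|/2 − 1) < E(|V|/2) + E(|V|/2 − 2)`,

i.e. the sector energies are STRICTLY CONVEX at the one-magnon rung (positive inverse compressibility at
the first step of the ladder; no pair binding of two magnons).  This is the `W = 1` instance of the theory
seat's THEOREM E-CONV (`XXZSectorEnergyConvex` of `…EnergyConvexityDefs`, proved there on paper for
`Δ ∈ [−1,1]` on every graph via real stability), obtained here UNCONDITIONALLY and for all `Δ < 1` from the
rank-one branch of the total-positivity layer: `E(|V|/2) = −Δm/4` (`lowestEnergy_zeroMagnon`), `E(|V|/2−1)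
= −Δ(m/4 − k/2) − k/2` (flat one-magnon state, `oneMagnon_sectorGS_eq_smul_flat`), and the branch level
`ε(Δ) = E(|V|/2−2) − (1−Δ)(m/4−k) + m/4` is POSITIVE (`rankOne_branch_state` on `twoMagnon_branch_setup`:
`L = H(1) + m/4 ⪰ 0` and `⟨t, ψ⟩ ≠ 0`), which is exactly the strict convexity.

Theory seat `hubbard-h0-rotor-theory-1`, memo ROTOR-THEORY-6 §67; H. Tasaki (2020) §2.4.  No definition
is introduced.
-/

set_option linter.dupNamespace false

noncomputable section

namespace Summit.HubbardSuperconductivity.HubbardSuperconductivity.Theorems.AnisotropyChord.TwoMagnon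

open Matrix Complex Finset
open scoped ComplexOrder
open Literature.MathematicalPhysics.QuantumLattice Literature.Probability.LatticeModels
open Literature.Combinatorics.SimpleGraph (IsVertexTransitive)
open Literature.Combinatorics.SimpleGraph.LovaszThetaEdgeTransitive (IsEdgeTransitive)
open Literature.Combinatorics.SimpleGraph.RankThreeStronglyRegular (isRegularOfDegree_of_isVertexTransitive)
open Summit.HubbardSuperconductivity.HubbardSuperconductivity.Theorems.AnisotropyChord.OneMagnon

variable {V : Type*} [Fintype V] [DecidableEq V] (G : SimpleGraph V) [DecidableRel G.Adj]

/-- **The zero-magnon sector energy is `−Δ|E|/4`** (the sector `S^z_tot = |V|/2` is spanned by the all-up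
configuration). Tasaki (2020) §2.4. [folklore] -/
theorem lowestEnergy_zeroMagnon [Nonempty V] (Δ : ℝ) :
    lowestEnergyInSector 1 (xxzHamiltonian 1 G (-1) Δ) ((Fintype.card V : ℝ) / 2) =
      -(Δ * ((G.edgeFinset.card : ℝ) / 4)) := by
  set H := (xxzHamiltonian 1 G (-1) Δ : Op V 2) with hHdef
  set K := spinZSector (Λ := V) 1 ((Fintype.card V : ℝ) / 2) with hKdef
  have hsec : ((Fintype.card V : ℝ) / 2) = (((Fintype.card V * 1 : ℕ) : ℝ) / 2 - ((0 : ℕ) : ℝ)) := by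
    push_cast; ring
  have hmemK : ∀ ψ : (V → Fin 2) → ℂ, ψ ∈ K ↔ ∀ σ, (∑ x, (σ x : ℕ)) ≠ 0 → ψ σ = 0 := by
    intro ψ
    rw [hKdef, hsec]
    exact LiebMattis.mem_spinZSector_weight_iff (Λ := V) 1 0 ψ
  have hw0 : ∀ σ : V → Fin 2, (∑ x, (σ x : ℕ)) = 0 → σ = 0 := by
    intro σ hσ
    funext z
    have hz : (σ z : ℕ) = 0 := by
      have := Finset.sum_eq_zero_iff.1 hσ z (Finset.mem_univ z)
      exact this
    exact Fin.ext (by simpa using hz)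
  -- the action of `H` on a vector supported at the all-up configuration
  have hH0 : ∀ ψ : (V → Fin 2) → ℂ, (∀ σ, (∑ x, (σ x : ℕ)) ≠ 0 → ψ σ = 0) →
      (H *ᵥ ψ) 0 = -((Δ * ((G.edgeFinset.card : ℝ) / 4) : ℝ) : ℂ) * ψ 0 := by
    intro ψ hψ
    rw [hHdef, xxz_mulVec_apply G Δ ψ 0]
    have hZ : (∑ e ∈ G.edgeFinset, Sym2.lift ⟨fun x y => ((1 : ℝ) / 2 - ((0 : V → Fin 2) x : ℕ)) *
        ((1 : ℝ) / 2 - ((0 : V → Fin 2) y : ℕ)), fun _ _ => mul_comm _ _⟩ e) = (G.edgeFinset.card : ℝ) / 4 := by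
      rw [Finset.sum_congr rfl (fun e _ => show Sym2.lift ⟨fun x y => ((1 : ℝ) / 2 - ((0 : V → Fin 2) x : ℕ)) *
          ((1 : ℝ) / 2 - ((0 : V → Fin 2) y : ℕ)), fun _ _ => mul_comm _ _⟩ e = (1 : ℝ) / 4 by
          induction e using Sym2.ind with
          | h x y => simp only [Sym2.lift_mk, Pi.zero_apply, Fin.val_zero, Nat.cast_zero, sub_zero]; norm_num),
        Finset.sum_const, nsmul_eq_mul]
      ring
    have hhop : (∑ e ∈ G.edgeFinset, Sym2.lift ⟨fun x y => if (0 : V → Fin 2) x ≠ (0 : V → Fin 2) y then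
        ψ ((0 : V → Fin 2) ∘ Equiv.swap x y) else 0, fun x y => by simp only [ne_comm, Equiv.swap_comm]⟩ e) = 0 := by
      refine Finset.sum_eq_zero fun e _ => ?_
      induction e using Sym2.ind with
      | h x y => simp
    rw [hZ, hhop, mul_zero, sub_zero]
  -- a normalised ground state of the sector
  have hinv : ∀ v ∈ K, H *ᵥ v ∈ K := by
    intro v hv
    rw [hmemK] at hv ⊢
    intro σ hσ
    rw [hHdef, xxz_mulVec_apply G Δ v σ, hv σ hσ, mul_zero, zero_sub, neg_eq_zero, mul_eq_zero]
    right
    refine Finset.sum_eq_zero fun e _ => ?_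
    induction e using Sym2.ind with
    | h x y =>
      simp only [Sym2.lift_mk]
      split_ifs
      · exact hv _ (by rw [weight_comp_swap]; exact hσ)
      · rfl
  have hne : K ≠ ⊥ := by
    rw [Submodule.ne_bot_iff]
    refine ⟨Pi.single (0 : V → Fin 2) (1 : ℂ), (hmemK _).2 fun σ hσ => ?_, ?_⟩
    · rw [Pi.single_eq_of_ne]
      intro h
      exact hσ (by rw [h]; simp)
    · intro h
      have := congrFun h 0
      rw [Pi.single_eq_same, Pi.zero_apply] at this
      exact one_ne_zero this
  obtain ⟨ψ, hmem, h1, heig⟩ := exists_unit_eigen_minEnergyOn (xxzHamiltonian_isHermitian 1 G (-1) Δ) K hinv hne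
  have hsupp := (hmemK ψ).1 hmem
  -- `ψ` is supported at `0`; compare the two expressions of `(Hψ)(0)`
  have hψ0 : ψ 0 ≠ 0 := by
    intro h0
    have : ψ = 0 := by
      funext σ
      by_cases hσ : (∑ x, (σ x : ℕ)) = 0
      · rw [hw0 σ hσ]; exact h0
      · exact hsupp σ hσ
    rw [this, dotProduct_zero] at h1
    exact zero_ne_one h1
  have e1 := congrFun heig 0
  rw [Pi.smul_apply, smul_eq_mul, hH0 ψ hsupp] at e1
  have := mul_right_cancel₀ hψ0 e1
  have hgoal : lowestEnergyInSector 1 H ((Fintype.card V : ℝ) / 2) = H.minEnergyOn K := rfl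
  rw [hgoal]
  rw [← Complex.ofReal_neg] at this
  exact (Complex.ofReal_injective this).symm

/-- **The one-magnon sector energy of a connected `k`-regular graph is `−Δ(|E|/4 − k/2) − k/2`** (the flat
one-magnon state is the ground state for every `Δ`). Tasaki (2020) §2.4. [folklore] -/
theorem lowestEnergy_oneMagnon (hG : G.Connected) {k : ℕ} (hreg : G.IsRegularOfDegree k) (Δ : ℝ) :
    lowestEnergyInSector 1 (xxzHamiltonian 1 G (-1) Δ) ((Fintype.card V : ℝ) / 2 - 1) =
      -(Δ * ((G.edgeFinset.card : ℝ) / 4 - (k : ℝ) / 2)) - (k : ℝ) / 2 := by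
  haveI : Nonempty V := hG.nonempty
  set u : (V → Fin 2) → ℂ := fun σ => if (∑ z, (σ z : ℕ)) = 1 then 1 else 0 with hudef
  have hu : ∀ σ, u σ = if (∑ z, (σ z : ℕ)) = 1 then 1 else 0 := fun σ => rfl
  obtain ⟨ψ, hmem, h1, heig⟩ := exists_oneMagnon_groundState G Δ
  obtain ⟨c, hc⟩ := oneMagnon_sectorGS_eq_smul_flat G hG hreg Δ hu hmem heig
  have hHu := xxz_mulVec_oneMagnonFlat G hreg Δ hu
  have hψ0 : ψ ≠ 0 := by
    intro h; rw [h, dotProduct_zero] at h1; exact zero_ne_one h1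
  have e1 : xxzHamiltonian 1 G (-1) Δ *ᵥ ψ =
      (((-(Δ * ((G.edgeFinset.card : ℝ) / 4 - (k : ℝ) / 2)) - (k : ℝ) / 2 : ℝ)) : ℂ) • ψ := by
    rw [hc, mulVec_smul, hHu, smul_comm]
  rw [heig] at e1
  obtain ⟨σ₀, hσ₀⟩ := Function.ne_iff.mp hψ0
  have e2 := congrFun e1 σ₀
  simp only [Pi.smul_apply, smul_eq_mul] at e2
  have := mul_right_cancel₀ hσ₀ e2
  exact_mod_cast this

/-- **Strict energy convexity at the one-magnon rung** (see the module docstring): on a finite connected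
vertex- and edge-transitive graph with two distinct vertices, for every `Δ < 1`,
`2·E(|V|/2 − 1) < E(|V|/2) + E(|V|/2 − 2)`.  The `W = 1` instance of the theory seat's E-CONV
(`XXZSectorEnergyConvex`), here from the positivity of the rank-one branch level.  Theory seat memo
ROTOR-THEORY-6 §67; Tasaki (2020) §2.4. [folklore] -/
theorem energyConvex_oneMagnon_of_edgeTransitive (hG : G.Connected) (hVT : IsVertexTransitive G)
    (hET : IsEdgeTransitive G) {i₀ j₀ : V} (hij : i₀ ≠ j₀) {Δ : ℝ} (hΔ : Δ < 1) :
    2 * lowestEnergyInSector 1 (xxzHamiltonian 1 G (-1) Δ) ((Fintype.card V : ℝ) / 2 - 1) <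
      lowestEnergyInSector 1 (xxzHamiltonian 1 G (-1) Δ) ((Fintype.card V : ℝ) / 2) +
        lowestEnergyInSector 1 (xxzHamiltonian 1 G (-1) Δ) ((Fintype.card V : ℝ) / 2 - 2) := by
  haveI : Nonempty V := hG.nonempty
  have hreg : G.IsRegularOfDegree (G.degree i₀) := isRegularOfDegree_of_isVertexTransitive hVT i₀
  -- a two-magnon ground state on the rank-one branch
  obtain ⟨ψ₂, g₂m, g₂n, g₂e⟩ := exists_twoMagnon_groundState G Δ hij
  set φ : (V → Fin 2) → ℂ := fun σ => if (∑ z, (σ z : ℕ)) = 2 then 1 else 0 with hφdef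
  have hφ : ∀ σ, φ σ = if (∑ z, (σ z : ℕ)) = 2 then 1 else 0 := fun σ => rfl
  have hφ0 : φ ≠ 0 := by
    intro h
    have h1 : φ (Pi.single i₀ 1 + Pi.single j₀ 1) = 0 := by rw [h]; rfl
    rw [hφ, if_pos (weight_pair hij)] at h1
    exact one_ne_zero h1
  obtain ⟨L, 𝓜, e, t, r, hL, h𝓜L, he𝓜, ht𝓜, hLe, he1, ha0, -, -, -, hbr⟩ :=
    twoMagnon_branch_setup G hG hVT hET i₀ hφ hφ0
  obtain ⟨hψ𝓜, hs, heq, hb, -, hvar, huniq⟩ := hbr Δ ψ₂ hΔ g₂m g₂n g₂e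
  obtain ⟨hε, -, -⟩ := rankOne_branch_state hL 𝓜 h𝓜L he𝓜 ht𝓜 hψ𝓜 hLe he1 ha0 hs heq g₂n hb hvar huniq
  -- the zero- and one-magnon energies
  rw [lowestEnergy_zeroMagnon G Δ, lowestEnergy_oneMagnon G hG hreg Δ]
  linarith

end Summit.HubbardSuperconductivity.HubbardSuperconductivity.Theorems.AnisotropyChord.TwoMagnon
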